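import Literature.NumberTheory.LFunctions.PoissonTwistedProgression
import Literature.NumberTheory.Sieve.FriedlanderIwaniecPrimesPoisson2D
import Mathlib.Data.ZMod.Basic
import HarnessLib

/-!
# Route `PrimeLevelFamEdge`, crux K_B (stmt-Parity-20343), line `diagonal_kernel_split`, plan Ω,
# sub-line **d1** — twisted Poisson summation in one and two variables

Plan Ω opens the Kloosterman sums `S(·,·;c)`, `c = qr`, inside the explicit off-diagonal
`PeterssonSplit.offDiag q l m` (helper H4) and executes the `(n₁,n₂)`-summation by Poisson's formula
in BOTH variables modulo `c` (Ω SUB-LINE SPLIT of record, d1–d5). This file is the abstract summation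
device («S-Poisson2»), with `G` the `c`-periodic arithmetic weight (downstream:
`G(x₁,x₂) = S(αx₁, βx₂; c)`) and `Φ` the smooth archimedean weight of one dyadic box (d4):

* one variable (`tsum_mul_periodic_eq`, smooth `f` of compact support; `tsum_mul_periodic_eq_of_decay`,
  `F` continuous of compact support with `𝓕F = O(|ξ|⁻²)`), for `g : ℤ → ℂ` with `g(m + cn) = g(m)`:
  `Σ_{n ∈ ℤ} f(n) g(n) = c⁻¹ Σ_{k ∈ ℤ} 𝓕f(k/c) · Σ_{0 ≤ x < c} g(x) e(xk/c)`
  (Mathlib's `𝓕f(ξ) = ∫ f(t) e(−tξ) dt`; the tree's Poisson summation along a progression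
  `FriedlanderIwaniecPrimes.tsum_arithProg_eq_tsum_fourier(_of_decay)`, one class `x + cm` at a time —
  the `d = 1` case of `MatomakiMerikoski2023_lemma34`, here also in the smoothness-free decay form);
* two variables (`tsum_tsum_mul_periodic_eq`), under EXACTLY the hypotheses of the tree's
  `FriedlanderIwaniecPrimes.tsum_tsum_arithProg₂` (`Φ` continuous of box support with smooth slices and
  `sup_{t₂} ∫ |∂₁²Φ(·,t₂)| ≤ C₁`) and `G : ℤ → ℤ → ℂ` `c`-periodic in each variable:
  `Σ_{n₁} Σ_{n₂} Φ(n₁,n₂) G(n₁,n₂)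
     = c⁻² Σ_{k₂} Σ_{k₁} Φ̂(k₁/c, k₂/c) · Σ_{0 ≤ x₁,x₂ < c} G(x₁,x₂) e(x₁k₁/c) e(x₂k₂/c)`,
  `Φ̂ = FriedlanderIwaniecPrimes.fourier2 Φ` (iterated transform). Proof: the one-variable smooth form
  in `n₂` for each `n₁`; the `n₁`-sum is finite (box support), so it commutes with `Σ_{k₂}`; then the
  one-variable decay form in `n₁` for the slice transform `Ψ_{k₂/c} = sliceFourier Φ (k₂/c)`
  (`fourier_sliceFourier_isBigO`), whose twist `Σ_{x₂} G(·,x₂)e(x₂k₂/c)` is again `c`-periodic;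
* packaging for the consumer d5 (`OffDiagPoissonApplied`): the left side as a sum over `ℤ × ℤ`
  (`tsum_prod_mul_eq_tsum_tsum`) and over `ℕ × ℕ` when `Φ` lives on the open quadrant
  (`tsum_nat_prod_eq_tsum_int_prod`), the right side as an absolutely convergent sum over the
  frequency lattice `ℤ × ℤ` given `Σ_{(k₁,k₂)} |Φ̂(k₁/c,k₂/c)| < ∞` (`tsum_prod_mul_periodic_eq`; d4/d5
  discharge this with `norm_fourier2_le_mixed`), and the residue-class form for
  `G(n₁,n₂) = K(n₁ mod c, n₂ mod c)`, `K : ZMod c → ZMod c → ℂ` (`tsum_tsum_mul_zmod_eq`,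
  `sum_range_eq_sum_zmod`).

Everything is folklore Fourier analysis, PROVED; theorems only, no definitions, no named facts, no
bound on any off-diagonal term. Helper; closes nothing.
«The programme SEARCHES and TYPES; no claim about Landau–Siegel zeros, Theorems 1–2 of arXiv:2211.02515
or a repaired Margin232 until a kernel theorem says so.»
-/

noncomputable section

open Real MeasureTheory Filter Complex Finset
open scoped FourierTransform Topology ContDiff

namespace Summit.Parity.GeneralizedHardyLittlewood.Theorems.BeyondDiagonalBeatsQuarter.OffDiagPoissonTwisted

open Literature.NumberTheory.Sieve.FriedlanderIwaniecPrimes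
open Literature.NumberTheory.LFunctions.MatomakiMerikoski (tsum_int_eq_sum_range_tsum
  summable_comp_progression_mul)

/-! ### Finite support along `ℤ`; size of the twisted period sums -/

/-- A compactly supported `F : ℝ → ℂ` sampled on `ℤ` and multiplied by any weight is summable
(the sum is finite). [folklore] -/
theorem summable_intCast_mul {F : ℝ → ℂ} (hFs : HasCompactSupport F) (a : ℤ → ℂ) :
    Summable fun n : ℤ => F n * a n :=
  (summable_comp_progression_mul hFs Nat.one_pos 0 a).congr fun n => by simp

/-- Integers outside `[-⌈R⌉₊, ⌈R⌉₊]` have absolute value `> R`. [folklore] -/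
theorem lt_abs_intCast_of_not_mem_Icc {R : ℝ} {n : ℤ}
    (hn : n ∉ Finset.Icc (-(⌈R⌉₊ : ℤ)) (⌈R⌉₊ : ℤ)) : R < |(n : ℝ)| := by
  rw [Finset.mem_Icc, not_and_or, not_le, not_le] at hn
  have hR : R ≤ (⌈R⌉₊ : ℝ) := Nat.le_ceil R
  have h0 : (0 : ℝ) ≤ (⌈R⌉₊ : ℝ) := Nat.cast_nonneg _
  rcases hn with h | h
  · have h' : (n : ℝ) < -(⌈R⌉₊ : ℝ) := by exact_mod_cast h
    rw [abs_of_neg (by linarith)]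
    linarith
  · have h' : (⌈R⌉₊ : ℝ) < n := by exact_mod_cast h
    rw [abs_of_pos (by linarith)]
    linarith

/-- `|Σ_{x<c} g(x) e(xk/c)| ≤ Σ_{x<c} |g(x)|`. [folklore] -/
theorem norm_sum_mul_fourierChar_le (c : ℕ) (g : ℤ → ℂ) (k : ℤ) :
    ‖∑ x ∈ Finset.range c, g x * (𝐞 ((x : ℝ) * k / c) : ℂ)‖ ≤ ∑ x ∈ Finset.range c, ‖g x‖ := by
  refine (norm_sum_le _ _).trans (le_of_eq (Finset.sum_congr rfl fun x _ => ?_))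
  rw [norm_mul, Circle.norm_coe, mul_one]

/-- `|Σ_{x₁,x₂<c} G(x₁,x₂) e(x₁k₁/c) e(x₂k₂/c)| ≤ Σ_{x₁,x₂<c} |G(x₁,x₂)|`. [folklore] -/
theorem norm_sum_sum_mul_fourierChar_le (c : ℕ) (G : ℤ → ℤ → ℂ) (k₁ k₂ : ℤ) :
    ‖∑ x₁ ∈ Finset.range c, ∑ x₂ ∈ Finset.range c,
        G x₁ x₂ * (𝐞 ((x₁ : ℝ) * k₁ / c) : ℂ) * (𝐞 ((x₂ : ℝ) * k₂ / c) : ℂ)‖ ≤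
      ∑ x₁ ∈ Finset.range c, ∑ x₂ ∈ Finset.range c, ‖G x₁ x₂‖ := by
  refine (norm_sum_le _ _).trans (Finset.sum_le_sum fun x₁ _ => ?_)
  refine (norm_sum_le _ _).trans (le_of_eq (Finset.sum_congr rfl fun x₂ _ => ?_))
  rw [norm_mul, norm_mul, Circle.norm_coe, Circle.norm_coe, mul_one, mul_one]

/-- Summability of the dual side: `k ↦ 𝓕F(k/c) · Σ_{x<c} g(x) e(xk/c)` is summable over `ℤ`
when `𝓕F = O(|ξ|⁻²)` (`c ≥ 1`). [folklore] -/
theorem summable_fourier_div_mul_twist {F : ℝ → ℂ}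
    (hdec : 𝓕 F =O[cocompact ℝ] fun ξ : ℝ => |ξ| ^ (-2 : ℝ)) {c : ℕ} (hc : 0 < c) (g : ℤ → ℂ) :
    Summable fun k : ℤ => 𝓕 F ((k : ℝ) / c) *
      ∑ x ∈ Finset.range c, g x * (𝐞 ((x : ℝ) * k / c) : ℂ) := by
  have hcr : (0 : ℝ) < c := by exact_mod_cast hc
  refine Summable.of_norm_bounded
    ((summable_fourier_div_of_decay hdec hcr).norm.mul_right (∑ x ∈ Finset.range c, ‖g x‖))
    (fun k => ?_)
  rw [norm_mul]
  exact mul_le_mul_of_nonneg_left (norm_sum_mul_fourierChar_le c g k) (norm_nonneg _)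

/-! ### One variable -/

/-- **Twisted Poisson summation in one variable (decay form).** For `F : ℝ → ℂ` continuous of compact
support with `𝓕F = O(|ξ|⁻²)`, `c ≥ 1` and `g : ℤ → ℂ` with `g(m + cn) = g(m)`:
`Σ_{n ∈ ℤ} F(n) g(n) = c⁻¹ Σ_{k ∈ ℤ} 𝓕F(k/c) · Σ_{0 ≤ x < c} g(x) e(xk/c)` (split `n = x + cm`, Poisson
summation along each progression, interchange the finite `x`-sum with the `k`-sum). [folklore] -/
theorem tsum_mul_periodic_eq_of_decay {F : ℝ → ℂ} (hFc : Continuous F)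
    (hFs : HasCompactSupport F) (hdec : 𝓕 F =O[cocompact ℝ] fun ξ : ℝ => |ξ| ^ (-2 : ℝ))
    {c : ℕ} (hc : 0 < c) {g : ℤ → ℂ} (hg : ∀ m n : ℤ, g (m + c * n) = g m) :
    ∑' n : ℤ, F n * g n =
      (c : ℂ)⁻¹ * ∑' k : ℤ, 𝓕 F ((k : ℝ) / c) *
        ∑ x ∈ Finset.range c, g x * (𝐞 ((x : ℝ) * k / c) : ℂ) := by
  have hcr : (0 : ℝ) < c := by exact_mod_cast hc
  -- Step 1: split `n = x + cm`; periodicity and Poisson summation in each class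
  rw [tsum_int_eq_sum_range_tsum _ (summable_intCast_mul hFs g) hc]
  have hclass : ∀ x ∈ Finset.range c,
      ∑' m : ℤ, F (((x : ℤ) + c * m : ℤ) : ℝ) * g ((x : ℤ) + c * m) =
        g x * ((c : ℂ)⁻¹ * ∑' k : ℤ, (𝐞 (((x : ℤ) : ℝ) * k / c) : ℂ) * 𝓕 F ((k : ℝ) / c)) := by
    intro x _
    rw [← tsum_arithProg_eq_tsum_fourier_of_decay hFc hFs hdec hc (x : ℤ), ← tsum_mul_left]
    refine tsum_congr fun m => ?_
    rw [hg, mul_comm]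
    congr 1
    push_cast
    ring_nf
  rw [Finset.sum_congr rfl hclass]
  -- Step 2: interchange the finite sum over `x` with the sum over `k`
  have hsumm : ∀ x ∈ Finset.range c, Summable fun k : ℤ =>
      g x * ((𝐞 (((x : ℤ) : ℝ) * k / c) : ℂ) * 𝓕 F ((k : ℝ) / c)) := by
    intro x _
    have h1 : Summable fun k : ℤ => (𝐞 (((x : ℤ) : ℝ) * k / c) : ℂ) * 𝓕 F ((k : ℝ) / c) :=
      Summable.of_norm_bounded (summable_fourier_div_of_decay hdec hcr).norm (fun k => by
        rw [norm_mul, Circle.norm_coe, one_mul])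
    exact h1.mul_left _
  calc ∑ x ∈ Finset.range c, g x * ((c : ℂ)⁻¹ * ∑' k : ℤ,
          (𝐞 (((x : ℤ) : ℝ) * k / c) : ℂ) * 𝓕 F ((k : ℝ) / c))
      = (c : ℂ)⁻¹ * ∑ x ∈ Finset.range c, ∑' k : ℤ,
          g x * ((𝐞 (((x : ℤ) : ℝ) * k / c) : ℂ) * 𝓕 F ((k : ℝ) / c)) := by
        rw [Finset.mul_sum]
        refine Finset.sum_congr rfl fun x _ => ?_
        rw [tsum_mul_left]
        ring
    _ = (c : ℂ)⁻¹ * ∑' k : ℤ, ∑ x ∈ Finset.range c,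
          g x * ((𝐞 (((x : ℤ) : ℝ) * k / c) : ℂ) * 𝓕 F ((k : ℝ) / c)) := by
        rw [Summable.tsum_finsetSum hsumm]
    _ = _ := by
        congr 1
        refine tsum_congr fun k => ?_
        rw [Finset.mul_sum]
        refine Finset.sum_congr rfl fun x _ => ?_
        push_cast
        ring

/-- **Twisted Poisson summation in one variable (smooth form).** For `f : ℝ → ℂ` smooth of compact
support, `c ≥ 1` and `g : ℤ → ℂ` with `g(m + cn) = g(m)`:
`Σ_{n ∈ ℤ} f(n) g(n) = c⁻¹ Σ_{k ∈ ℤ} 𝓕f(k/c) · Σ_{0 ≤ x < c} g(x) e(xk/c)`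
(the case `d = 1`, `b = 0` of Matomäki–Merikoski's Lemma 3.4, `MatomakiMerikoski2023_lemma34`). [folklore] -/
theorem tsum_mul_periodic_eq {f : ℝ → ℂ} (hf : ContDiff ℝ ∞ f) (hfc : HasCompactSupport f)
    {c : ℕ} (hc : 0 < c) {g : ℤ → ℂ} (hg : ∀ m n : ℤ, g (m + c * n) = g m) :
    ∑' n : ℤ, f n * g n =
      (c : ℂ)⁻¹ * ∑' k : ℤ, 𝓕 f ((k : ℝ) / c) *
        ∑ x ∈ Finset.range c, g x * (𝐞 ((x : ℝ) * k / c) : ℂ) :=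
  tsum_mul_periodic_eq_of_decay hf.continuous hfc (fourier_isBigO_rpow_neg_two hf hfc) hc hg

/-! ### Two variables -/

section TwoVariables

variable {Φ : ℝ → ℝ → ℂ} {R : ℝ}

/-- A twist in the second variable keeps periodicity in the first:
`Σ_{x₂<c} G(m + cn, x₂) e(x₂k₂/c) = Σ_{x₂<c} G(m, x₂) e(x₂k₂/c)`. [folklore] -/
theorem sum_twist_periodic_left {c : ℕ} {G : ℤ → ℤ → ℂ}
    (hG₁ : ∀ u v n : ℤ, G (u + c * n) v = G u v) (k₂ m n : ℤ) :
    ∑ x₂ ∈ Finset.range c, G (m + c * n) x₂ * (𝐞 ((x₂ : ℝ) * k₂ / c) : ℂ) =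
      ∑ x₂ ∈ Finset.range c, G m x₂ * (𝐞 ((x₂ : ℝ) * k₂ / c) : ℂ) :=
  Finset.sum_congr rfl fun x₂ _ => by rw [hG₁]

/-- **Twisted Poisson summation in two variables** (iterated form). For `Φ : ℝ → ℝ → ℂ` continuous of
box support `[-R,R]²` with smooth slices and `sup_{t₂} ∫ |∂₁²Φ(·,t₂)| ≤ C₁` (the hypotheses of
`FriedlanderIwaniecPrimes.tsum_tsum_arithProg₂`), `c ≥ 1`, and `G : ℤ → ℤ → ℂ` `c`-periodic in each
variable:
`Σ_{n₁} Σ_{n₂} Φ(n₁,n₂) G(n₁,n₂) = c⁻² Σ_{k₂} Σ_{k₁} Φ̂(k₁/c,k₂/c) · Σ_{0 ≤ x₁,x₂ < c} G(x₁,x₂) e(x₁k₁/c) e(x₂k₂/c)`,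
`Φ̂ = fourier2 Φ`. [folklore] -/
theorem tsum_tsum_mul_periodic_eq (h : BoxSupport Φ R) (hc : Continuous (Function.uncurry Φ))
    (hR : 0 ≤ R) (hs₁ : ∀ t₂, ContDiff ℝ ∞ (fun t₁ => Φ t₁ t₂)) (hs₂ : ∀ t₁, ContDiff ℝ ∞ (Φ t₁))
    {C₁ : ℝ} (hC : ∀ t₂, (∫ t₁, ‖iteratedDeriv 2 (fun t₁ => Φ t₁ t₂) t₁‖) ≤ C₁)
    {c : ℕ} (hc0 : 0 < c) {G : ℤ → ℤ → ℂ}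
    (hG₁ : ∀ u v n : ℤ, G (u + c * n) v = G u v) (hG₂ : ∀ u v n : ℤ, G u (v + c * n) = G u v) :
    ∑' n₁ : ℤ, ∑' n₂ : ℤ, Φ n₁ n₂ * G n₁ n₂ =
      ((c : ℂ)⁻¹) ^ 2 * ∑' k₂ : ℤ, ∑' k₁ : ℤ, fourier2 Φ (k₁ / c) (k₂ / c) *
        ∑ x₁ ∈ Finset.range c, ∑ x₂ ∈ Finset.range c,
          G x₁ x₂ * (𝐞 ((x₁ : ℝ) * k₁ / c) : ℂ) * (𝐞 ((x₂ : ℝ) * k₂ / c) : ℂ) := by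
  have hcr : (0 : ℝ) < c := by exact_mod_cast hc0
  -- the twisted period sum in `x₂`: periodic in `n₁`, bounded
  set T : ℤ → ℤ → ℂ := fun n₁ k₂ =>
    ∑ x₂ ∈ Finset.range c, G n₁ x₂ * (𝐞 ((x₂ : ℝ) * k₂ / c) : ℂ) with hT
  have hTper : ∀ k₂ m n : ℤ, T (m + c * n) k₂ = T m k₂ := fun k₂ m n =>
    sum_twist_periodic_left hG₁ k₂ m n
  have hTle : ∀ n₁ k₂ : ℤ, ‖T n₁ k₂‖ ≤ ∑ x₂ ∈ Finset.range c, ‖G n₁ x₂‖ := fun n₁ k₂ =>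
    norm_sum_mul_fourierChar_le c (G n₁) k₂
  -- Step 1: twisted Poisson summation in `n₂` (smooth form), for each `n₁`
  have step1 : ∀ n₁ : ℤ, ∑' n₂ : ℤ, Φ n₁ n₂ * G n₁ n₂ =
      (c : ℂ)⁻¹ * ∑' k₂ : ℤ, sliceFourier Φ (k₂ / c) n₁ * T n₁ k₂ := fun n₁ =>
    tsum_mul_periodic_eq (f := Φ n₁) (g := G n₁) (hs₂ _) (h.hasCompactSupport_right _) hc0 (hG₂ n₁)
  simp_rw [step1]
  -- Step 2: the `n₁`-sum is finite (box support) and commutes with the `k₂`-sum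
  set S : Finset ℤ := Finset.Icc (-(⌈R⌉₊ : ℤ)) (⌈R⌉₊ : ℤ) with hS
  have hout : ∀ n₁ ∉ S, ∀ ξ₂ : ℝ, sliceFourier Φ ξ₂ n₁ = 0 := fun n₁ hn ξ₂ =>
    sliceFourier_eq_zero h ξ₂ (lt_abs_intCast_of_not_mem_Icc hn)
  have hzero : ∀ n₁ ∉ S, (c : ℂ)⁻¹ * ∑' k₂ : ℤ, sliceFourier Φ (k₂ / c) n₁ * T n₁ k₂ = 0 := by
    intro n₁ hn
    simp [hout n₁ hn]
  have hsum : ∀ n₁ ∈ S, Summable fun k₂ : ℤ => sliceFourier Φ (k₂ / c) n₁ * T n₁ k₂ := by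
    intro n₁ _
    refine Summable.of_norm_bounded
      ((summable_fourier_div (hs₂ (n₁ : ℝ)) (h.hasCompactSupport_right _) hcr).norm.mul_right
        (∑ x₂ ∈ Finset.range c, ‖G n₁ x₂‖)) (fun k₂ => ?_)
    rw [norm_mul]
    exact mul_le_mul_of_nonneg_left (hTle n₁ k₂) (norm_nonneg _)
  rw [tsum_eq_sum hzero, ← Finset.mul_sum, ← Summable.tsum_finsetSum hsum]
  -- Step 3: for each `k₂`, back to all `n₁` and twisted Poisson summation in `n₁` (decay form)
  have step3 : ∀ k₂ : ℤ, ∑ n₁ ∈ S, sliceFourier Φ (k₂ / c) n₁ * T n₁ k₂ =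
      (c : ℂ)⁻¹ * ∑' k₁ : ℤ, fourier2 Φ (k₁ / c) (k₂ / c) *
        ∑ x₁ ∈ Finset.range c, T x₁ k₂ * (𝐞 ((x₁ : ℝ) * k₁ / c) : ℂ) := by
    intro k₂
    have hz : ∀ n₁ ∉ S, sliceFourier Φ (k₂ / c) n₁ * T n₁ k₂ = 0 := fun n₁ hn => by
      rw [hout n₁ hn, zero_mul]
    rw [show (∑ n₁ ∈ S, sliceFourier Φ (k₂ / c) n₁ * T n₁ k₂) =
        ∑' n₁ : ℤ, sliceFourier Φ (k₂ / c) n₁ * T n₁ k₂ from (tsum_eq_sum hz).symm]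
    exact tsum_mul_periodic_eq_of_decay (F := sliceFourier Φ (k₂ / c)) (g := fun n₁ => T n₁ k₂)
      (continuous_sliceFourier h hc _) (hasCompactSupport_sliceFourier h _)
      (fourier_sliceFourier_isBigO h hc hR hs₁ hC _) hc0 (hTper k₂)
  simp_rw [step3]
  -- Step 4: constants; open the twisted period sum `T`
  rw [tsum_mul_left, ← mul_assoc, ← pow_two]
  congr 1
  refine tsum_congr fun k₂ => tsum_congr fun k₁ => ?_
  congr 1
  refine Finset.sum_congr rfl fun x₁ _ => ?_
  simp only [hT, Finset.sum_mul]
  exact Finset.sum_congr rfl fun x₂ _ => by ring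

/-! ### Packaging for the consumer: sums over `ℤ × ℤ`, `ℕ × ℕ`, and residues `ZMod c` -/

/-- Box support makes `(n₁,n₂) ↦ Φ(n₁,n₂) G(n₁,n₂)` finitely supported, hence summable on `ℤ × ℤ`.
[folklore] -/
theorem summable_prod_mul (h : BoxSupport Φ R) (G : ℤ → ℤ → ℂ) :
    Summable fun n : ℤ × ℤ => Φ n.1 n.2 * G n.1 n.2 := by
  set S : Finset ℤ := Finset.Icc (-(⌈R⌉₊ : ℤ)) (⌈R⌉₊ : ℤ) with hS
  refine summable_of_ne_finset_zero (s := S ×ˢ S) fun n hn => ?_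
  rw [Finset.mem_product, not_and_or] at hn
  have hΦ : Φ n.1 n.2 = 0 := by
    by_contra hne
    obtain ⟨h1, h2⟩ := h _ _ hne
    rcases hn with hn | hn
    · exact absurd h1 (not_le.mpr (lt_abs_intCast_of_not_mem_Icc hn))
    · exact absurd h2 (not_le.mpr (lt_abs_intCast_of_not_mem_Icc hn))
  rw [hΦ, zero_mul]

/-- The double sum over `ℤ × ℤ` is the iterated sum. [folklore] -/
theorem tsum_prod_mul_eq_tsum_tsum (h : BoxSupport Φ R) (G : ℤ → ℤ → ℂ) :
    ∑' n : ℤ × ℤ, Φ n.1 n.2 * G n.1 n.2 = ∑' n₁ : ℤ, ∑' n₂ : ℤ, Φ n₁ n₂ * G n₁ n₂ :=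
  (summable_prod_mul h G).tsum_prod

/-- If `Φ` lives on the open quadrant (`Φ(t₁,t₂) ≠ 0 ⇒ t₁ > 0 ∧ t₂ > 0`), the sum over `ℤ × ℤ` is the
sum over pairs of natural numbers. [folklore] -/
theorem tsum_nat_prod_eq_tsum_int_prod (hpos : ∀ t₁ t₂, Φ t₁ t₂ ≠ 0 → 0 < t₁ ∧ 0 < t₂)
    (G : ℤ → ℤ → ℂ) :
    ∑' n : ℕ × ℕ, Φ n.1 n.2 * G n.1 n.2 = ∑' n : ℤ × ℤ, Φ n.1 n.2 * G n.1 n.2 := by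
  have hinj : Function.Injective (fun n : ℕ × ℕ => ((n.1 : ℤ), (n.2 : ℤ))) := by
    intro a b hab
    simp only [Prod.mk.injEq, Nat.cast_inj] at hab
    exact Prod.ext hab.1 hab.2
  have key := hinj.tsum_eq (f := fun n : ℤ × ℤ => Φ n.1 n.2 * G n.1 n.2) ?_
  · simpa using key
  · intro n hn
    rw [Function.mem_support] at hn
    obtain ⟨h1, h2⟩ := hpos _ _ (left_ne_zero_of_mul hn)
    have h1' : (0 : ℤ) ≤ n.1 := by exact_mod_cast h1.le
    have h2' : (0 : ℤ) ≤ n.2 := by exact_mod_cast h2.le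
    exact ⟨(n.1.toNat, n.2.toNat), by simp [Int.toNat_of_nonneg h1', Int.toNat_of_nonneg h2']⟩

/-- For `W : ℤ → ℤ → ℂ` absolutely summable on `ℤ × ℤ`: `Σ_{k₂} Σ_{k₁} W(k₁,k₂) = Σ_{(k₁,k₂) ∈ ℤ × ℤ} W(k₁,k₂)`
(the iterated sum in the swapped order is the lattice sum). [folklore] -/
theorem tsum_tsum_eq_tsum_prod_swap {W : ℤ → ℤ → ℂ} (hW : Summable fun k : ℤ × ℤ => W k.1 k.2) :
    ∑' k₂ : ℤ, ∑' k₁ : ℤ, W k₁ k₂ = ∑' k : ℤ × ℤ, W k.1 k.2 := by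
  have h2 : Summable fun p : ℤ × ℤ => W (Equiv.prodComm ℤ ℤ p).1 (Equiv.prodComm ℤ ℤ p).2 :=
    (Equiv.prodComm ℤ ℤ).summable_iff.mpr hW
  rw [← (Equiv.prodComm ℤ ℤ).tsum_eq (fun k : ℤ × ℤ => W k.1 k.2), h2.tsum_prod]
  simp only [Equiv.prodComm_apply, Prod.swap_prod_mk]

/-- **Twisted Poisson summation in two variables, lattice form.** Under the hypotheses of
`tsum_tsum_mul_periodic_eq` and, in addition, `Σ_{(k₁,k₂) ∈ ℤ²} |Φ̂(k₁/c,k₂/c)| < ∞`, both sides are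
absolutely convergent sums over `ℤ × ℤ`:
`Σ_{(n₁,n₂)} Φ(n₁,n₂) G(n₁,n₂) = c⁻² Σ_{(k₁,k₂)} Φ̂(k₁/c,k₂/c) · Σ_{x₁,x₂<c} G(x₁,x₂) e(x₁k₁/c) e(x₂k₂/c)`.
[folklore] -/
theorem tsum_prod_mul_periodic_eq (h : BoxSupport Φ R) (hc : Continuous (Function.uncurry Φ))
    (hR : 0 ≤ R) (hs₁ : ∀ t₂, ContDiff ℝ ∞ (fun t₁ => Φ t₁ t₂)) (hs₂ : ∀ t₁, ContDiff ℝ ∞ (Φ t₁))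
    {C₁ : ℝ} (hC : ∀ t₂, (∫ t₁, ‖iteratedDeriv 2 (fun t₁ => Φ t₁ t₂) t₁‖) ≤ C₁)
    {c : ℕ} (hc0 : 0 < c) {G : ℤ → ℤ → ℂ}
    (hG₁ : ∀ u v n : ℤ, G (u + c * n) v = G u v) (hG₂ : ∀ u v n : ℤ, G u (v + c * n) = G u v)
    (hsum : Summable fun k : ℤ × ℤ => fourier2 Φ (k.1 / c) (k.2 / c)) :
    ∑' n : ℤ × ℤ, Φ n.1 n.2 * G n.1 n.2 =
      ((c : ℂ)⁻¹) ^ 2 * ∑' k : ℤ × ℤ, fourier2 Φ (k.1 / c) (k.2 / c) *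
        ∑ x₁ ∈ Finset.range c, ∑ x₂ ∈ Finset.range c,
          G x₁ x₂ * (𝐞 ((x₁ : ℝ) * k.1 / c) : ℂ) * (𝐞 ((x₂ : ℝ) * k.2 / c) : ℂ) := by
  rw [tsum_prod_mul_eq_tsum_tsum h G, tsum_tsum_mul_periodic_eq h hc hR hs₁ hs₂ hC hc0 hG₁ hG₂]
  congr 1
  have hWs : Summable fun k : ℤ × ℤ => fourier2 Φ (k.1 / c) (k.2 / c) *
      ∑ x₁ ∈ Finset.range c, ∑ x₂ ∈ Finset.range c,
        G x₁ x₂ * (𝐞 ((x₁ : ℝ) * k.1 / c) : ℂ) * (𝐞 ((x₂ : ℝ) * k.2 / c) : ℂ) := by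
    refine Summable.of_norm_bounded (hsum.norm.mul_right
      (∑ x₁ ∈ Finset.range c, ∑ x₂ ∈ Finset.range c, ‖G x₁ x₂‖)) (fun k => ?_)
    rw [norm_mul]
    exact mul_le_mul_of_nonneg_left (norm_sum_sum_mul_fourierChar_le c G k.1 k.2) (norm_nonneg _)
  exact tsum_tsum_eq_tsum_prod_swap hWs

/-- Reindexing a period sum by residue classes: for `c ≥ 1`, `K : ZMod c → ℂ` and any weight `w`,
`Σ_{0 ≤ x < c} K(x mod c) w(x) = Σ_{y ∈ ZMod c} K(y) w(val y)`. [folklore] -/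
theorem sum_range_eq_sum_zmod {c : ℕ} [NeZero c] (K : ZMod c → ℂ) (w : ℕ → ℂ) :
    ∑ x ∈ Finset.range c, K (x : ZMod c) * w x = ∑ y : ZMod c, K y * w y.val := by
  refine Finset.sum_nbij' (fun x : ℕ => (x : ZMod c)) (fun y : ZMod c => y.val)
    (fun _ _ => Finset.mem_univ _) (fun y _ => Finset.mem_range.mpr (ZMod.val_lt y))
    (fun x hx => ?_) (fun y _ => ?_) (fun x hx => ?_)
  · exact ZMod.val_cast_of_lt (Finset.mem_range.mp hx)
  · exact ZMod.natCast_zmod_val y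
  · rw [ZMod.val_cast_of_lt (Finset.mem_range.mp hx)]

/-- `n ↦ K(n mod c, ·)` and `n ↦ K(·, n mod c)` are `c`-periodic. [folklore] -/
theorem zmod_periodic {c : ℕ} (K : ZMod c → ZMod c → ℂ) (u v n : ℤ) :
    K ((u + c * n : ℤ) : ZMod c) (v : ZMod c) = K (u : ZMod c) (v : ZMod c) ∧
      K (u : ZMod c) ((v + c * n : ℤ) : ZMod c) = K (u : ZMod c) (v : ZMod c) := by
  constructor <;> · congr 1; push_cast; simp

/-- **Twisted Poisson summation in two variables, residue-class form.** For `Φ` as in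
`tsum_tsum_mul_periodic_eq`, `c ≥ 1` and `K : ZMod c → ZMod c → ℂ` (downstream: `K(y₁,y₂) = S(αy₁, βy₂; c)`):
`Σ_{n₁} Σ_{n₂} Φ(n₁,n₂) K(n₁ mod c, n₂ mod c)
   = c⁻² Σ_{k₂} Σ_{k₁} Φ̂(k₁/c,k₂/c) · Σ_{y₁,y₂ ∈ ZMod c} K(y₁,y₂) e(val(y₁)k₁/c) e(val(y₂)k₂/c)`. [folklore] -/
theorem tsum_tsum_mul_zmod_eq (h : BoxSupport Φ R) (hc : Continuous (Function.uncurry Φ))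
    (hR : 0 ≤ R) (hs₁ : ∀ t₂, ContDiff ℝ ∞ (fun t₁ => Φ t₁ t₂)) (hs₂ : ∀ t₁, ContDiff ℝ ∞ (Φ t₁))
    {C₁ : ℝ} (hC : ∀ t₂, (∫ t₁, ‖iteratedDeriv 2 (fun t₁ => Φ t₁ t₂) t₁‖) ≤ C₁)
    {c : ℕ} [NeZero c] (K : ZMod c → ZMod c → ℂ) :
    ∑' n₁ : ℤ, ∑' n₂ : ℤ, Φ n₁ n₂ * K (n₁ : ZMod c) (n₂ : ZMod c) =
      ((c : ℂ)⁻¹) ^ 2 * ∑' k₂ : ℤ, ∑' k₁ : ℤ, fourier2 Φ (k₁ / c) (k₂ / c) *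
        ∑ y₁ : ZMod c, ∑ y₂ : ZMod c,
          K y₁ y₂ * (𝐞 ((y₁.val : ℝ) * k₁ / c) : ℂ) * (𝐞 ((y₂.val : ℝ) * k₂ / c) : ℂ) := by
  have hc0 : 0 < c := Nat.pos_of_ne_zero (NeZero.ne c)
  have main := tsum_tsum_mul_periodic_eq (G := fun u v : ℤ => K (u : ZMod c) (v : ZMod c))
    h hc hR hs₁ hs₂ hC hc0 (fun u v n => (zmod_periodic K u v n).1)
    (fun u v n => (zmod_periodic K u v n).2)
  rw [main]
  congr 1
  refine tsum_congr fun k₂ => tsum_congr fun k₁ => ?_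
  congr 1
  -- reindex `x₂`, then `x₁`, by residues
  have inner : ∀ x₁ : ℕ, ∑ x₂ ∈ Finset.range c,
      K (x₁ : ZMod c) ((x₂ : ℤ) : ZMod c) * (𝐞 ((x₁ : ℝ) * k₁ / c) : ℂ) * (𝐞 ((x₂ : ℝ) * k₂ / c) : ℂ) =
        ∑ y₂ : ZMod c, K (x₁ : ZMod c) y₂ * (𝐞 ((x₁ : ℝ) * k₁ / c) : ℂ) *
          (𝐞 ((y₂.val : ℝ) * k₂ / c) : ℂ) := by
    intro x₁
    have := sum_range_eq_sum_zmod (fun y₂ => K (x₁ : ZMod c) y₂ * (𝐞 ((x₁ : ℝ) * k₁ / c) : ℂ))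
      (fun x₂ => (𝐞 ((x₂ : ℝ) * k₂ / c) : ℂ))
    simpa using this
  have houter := sum_range_eq_sum_zmod
    (fun y₁ => ∑ y₂ : ZMod c, K y₁ y₂ * (𝐞 ((y₂.val : ℝ) * k₂ / c) : ℂ))
    (fun x₁ => (𝐞 ((x₁ : ℝ) * k₁ / c) : ℂ))
  calc ∑ x₁ ∈ Finset.range c, ∑ x₂ ∈ Finset.range c,
        K ((x₁ : ℤ) : ZMod c) ((x₂ : ℤ) : ZMod c) * (𝐞 ((x₁ : ℝ) * k₁ / c) : ℂ) *
          (𝐞 ((x₂ : ℝ) * k₂ / c) : ℂ)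
      = ∑ x₁ ∈ Finset.range c, (∑ y₂ : ZMod c, K (x₁ : ZMod c) y₂ *
          (𝐞 ((y₂.val : ℝ) * k₂ / c) : ℂ)) * (𝐞 ((x₁ : ℝ) * k₁ / c) : ℂ) := by
        refine Finset.sum_congr rfl fun x₁ _ => ?_
        rw [Int.cast_natCast, inner x₁, Finset.sum_mul]
        exact Finset.sum_congr rfl fun y₂ _ => by ring
    _ = ∑ y₁ : ZMod c, (∑ y₂ : ZMod c, K y₁ y₂ * (𝐞 ((y₂.val : ℝ) * k₂ / c) : ℂ)) *
          (𝐞 ((y₁.val : ℝ) * k₁ / c) : ℂ) := houter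
    _ = _ := by
        refine Finset.sum_congr rfl fun y₁ _ => ?_
        rw [Finset.sum_mul]
        exact Finset.sum_congr rfl fun y₂ _ => by ring

end TwoVariables

end Summit.Parity.GeneralizedHardyLittlewood.Theorems.BeyondDiagonalBeatsQuarter.OffDiagPoissonTwisted
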